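import Summits.ResolutionOfSingularities.ResolutionOfSingularities.Theorems.FrobeniusLadderFRationalResolutionRegularRingLocalization
import Mathlib.Algebra.MonoidAlgebra.Basic
import Mathlib.Algebra.MonoidAlgebra.MapDomain
import Mathlib.Algebra.Polynomial.Laurent
import Mathlib.RingTheory.Adjoin.Basic
import Mathlib.RingTheory.RegularLocalRing.Polynomial
import Mathlib.RingTheory.Localization.Away.Basic
import HarnessLib

/-!
# Toric surface programme: the degenerate cones `TA[0, a]` are regular rings

Support file for crux stmt-ResolutionOfSingularities-15317 (`FrobeniusLadder.FRationalResolution`),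
line `redirect`, lead c4 (toric surface programme: `U(r,a) = Spec k[{m ∈ ℤ² : 0 ≤ m₂, a m₂ ≤ r m₁}]`
over every field is resolved by the Hirzebruch–Jung tower for `a < r`; this file disposes of the
degenerate parameter `r = 0`, where the algebra is a localization of a polynomial ring, hence
regular, so that the headline holds for ALL `(r, a)`). Stub `stub_toric_degenerate_isRegularRing`.

With `r = 0` the cone condition reads `0 ≤ m₂ ∧ a m₂ ≤ 0`, so
* for `1 ≤ a` the lattice points are the line `ℤ × {0}` (`toricDegenerate_mem_iff_of_pos`) and
  `TA[0, a] = k[ℤ × {0}] ⊆ k[ℤ²]` is a copy of the Laurent polynomial ring `k[t, t⁻¹] = k[ℤ]`;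
* for `a = 0` they form the half plane `ℤ × ℕ` (`toricDegenerate_mem_iff_zero`) and
  `TA[0, 0] = k[ℤ × ℕ] ⊆ k[ℤ²]` is a copy of `k[t, t⁻¹][s] = k[ℤ × ℕ]`.

Both abstract algebras are regular:
* `toricDegenerate_laurentPolynomial_isRegularRing` — `R[t, t⁻¹]` (Mathlib `LaurentPolynomial R
  = AddMonoidAlgebra R ℤ`) is regular for every regular ring `R`: it is the localization of the
  regular ring `R[X]` (Mathlib `Polynomial.isRegularRing_of_isRegularRing`) away from `X` (Mathlib
  `LaurentPolynomial.isLocalization`), so it is ring-isomorphic (`IsLocalization.algEquiv`) to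
  `Localization.Away X`, which is regular by the tree's `stub_isRegularRing_localization`
  (localizations of regular rings are regular); transport along `IsRegularRing.of_ringEquiv`;
* `toricDegenerate_halfPlaneAlgebra_isRegularRing` — `k[ℤ × ℕ] ≅ (k[ℕ])[ℤ]` (Mathlib
  `AddMonoidAlgebra.curryRingEquiv`) with `k[ℕ] ≅ k[X]` (Mathlib `Polynomial.toFinsuppIso`)
  regular, so the previous item applies with `R = k[ℕ]`.

The identification of `TA[0, a]` with them is the lattice-embedding argument of the base case
(`…ToricBaseRegular.lean`): for an injective additive map `ι : G → ℤ²` the `k`-algebra map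
`k[G] → k[ℤ²]`, `χᵍ ↦ χ^{ι g}` (`AddMonoidAlgebra.mapDomainAlgHom`) is injective
(`AddMonoidAlgebra.mapDomain_injective`) with range the monomial algebra `k[ι(G)]`
(`toricDegenerate_range_mapDomainAlgHom`), whence `k[ι(G)] ≅ k[G]` (`AlgEquiv.ofInjective`,
`Subalgebra.equivOfEq`) is regular when `k[G]` is (`toricDegenerate_isRegularRing_adjoin`); it is
applied to `ι = (n ↦ (n, 0)) : ℤ → ℤ²` for `1 ≤ a` and to `ι = ((n, d) ↦ (n, d)) : ℤ × ℕ → ℤ²` for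
`a = 0` (`stub_toric_degenerate_isRegularRing`).

All folklore (Cox–Little–Schenck 2011, Ex. 1.2.21 and Prop. 1.3.11; Fulton 1993, §2.1; Matsumura,
*Commutative Ring Theory*, Thm. 19.5: polynomial rings and localizations of regular rings are
regular); no published fact is used and no definition is introduced (the lattice maps are inline
terms). [folklore]
-/

set_option linter.dupNamespace false

noncomputable section

namespace Summit.ResolutionOfSingularities.ResolutionOfSingularities.Theorems.FRationalResolution

open Polynomial in
/-- **Laurent polynomial rings over regular rings are regular.** For a regular ring `R`, the ring
`R[t, t⁻¹] = R[ℤ]` (Mathlib `LaurentPolynomial R`) is the localization of the regular ring `R[X]`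
away from `X` (`LaurentPolynomial.isLocalization`), hence ring-isomorphic to
`Localization.Away X` (`IsLocalization.algEquiv`), a localization of a regular ring, which is
regular (`stub_isRegularRing_localization`). [folklore; Matsumura, Thm. 19.5] -/
theorem toricDegenerate_laurentPolynomial_isRegularRing (R : Type) [CommRing R]
    [IsRegularRing R] : IsRegularRing (LaurentPolynomial R) := by
  haveI := stub_isRegularRing_localization (R := R[X]) (Submonoid.powers (X : R[X]))
  exact IsRegularRing.of_ringEquiv (IsLocalization.algEquiv (Submonoid.powers (X : R[X]))
    (Localization.Away (X : R[X])) (LaurentPolynomial R)).toRingEquiv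

/-- **The half-plane monoid algebra `k[ℤ × ℕ]` is regular**: it is ring-isomorphic to the
Laurent polynomial ring `(k[ℕ])[ℤ]` (`AddMonoidAlgebra.curryRingEquiv`) over `k[ℕ] ≅ k[X]`
(`Polynomial.toFinsuppIso`), a regular ring, so
`toricDegenerate_laurentPolynomial_isRegularRing` applies. [folklore] -/
theorem toricDegenerate_halfPlaneAlgebra_isRegularRing (k : Type) [Field k] :
    IsRegularRing (AddMonoidAlgebra k (ℤ × ℕ)) := by
  haveI : IsRegularRing (AddMonoidAlgebra k ℕ) :=
    IsRegularRing.of_ringEquiv (Polynomial.toFinsuppIso k)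
  haveI := toricDegenerate_laurentPolynomial_isRegularRing (AddMonoidAlgebra k ℕ)
  exact IsRegularRing.of_ringEquiv
    (AddMonoidAlgebra.curryRingEquiv (R := k) (M := ℤ) (N := ℕ)).symm

section Toric

variable (k : Type) [Field k]

/-- The Laurent polynomial ring `k[ℤ²]` (coordinate ring of the 2-torus). -/
local notation3 "Lk" => AddMonoidAlgebra k (ℤ × ℤ)

/-- The lattice points of the dual cone `σ∨ = {m₂ ≥ 0, a m₂ ≤ r m₁}` of `σ = cone((0,1),(r,-a))`. -/
local notation3 "σS[" r ", " a "]" =>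
  {m : ℤ × ℤ | 0 ≤ m.2 ∧ ((a : ℕ) : ℤ) * m.2 ≤ ((r : ℕ) : ℤ) * m.1}

/-- The toric surface algebra `k[σ∨ ∩ ℤ²] ⊆ k[ℤ²]`. -/
local notation3 "TA[" r ", " a "]" =>
  Algebra.adjoin k ((fun m : ℤ × ℤ => AddMonoidAlgebra.single m (1 : k)) '' σS[r, a])

/-- **Range of a lattice embedding.** For an additive map `ι : G → ℤ²` and a set `S ⊆ ℤ²` of
lattice points with `S = ι(G)`, the range of the `k`-algebra map `k[G] → k[ℤ²]`, `χᵍ ↦ χ^{ι g}`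
(`AddMonoidAlgebra.mapDomainAlgHom`), is the monomial algebra `k[S] ⊆ k[ℤ²]` generated by the
`χᵐ`, `m ∈ S`: every `c·χᵍ ↦ c • χ^{ι g}` is a scalar multiple of a generator, and every generator
`χ^{ι g}` is the image of `χᵍ`. [folklore] -/
theorem toricDegenerate_range_mapDomainAlgHom {G : Type} [AddCommMonoid G] (ι : G →+ ℤ × ℤ)
    (S : Set (ℤ × ℤ)) (hS : ∀ m, m ∈ S ↔ ∃ g, ι g = m) :
    (AddMonoidAlgebra.mapDomainAlgHom k k ι).range =
      Algebra.adjoin k ((fun m : ℤ × ℤ => AddMonoidAlgebra.single m (1 : k)) '' S) := by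
  apply le_antisymm
  · intro x hx
    obtain ⟨p, rfl⟩ := (AlgHom.mem_range _).mp hx
    induction p using AddMonoidAlgebra.induction_linear with
    | zero => rw [map_zero]; exact zero_mem _
    | add x y hx' hy' => rw [map_add]; exact add_mem (hx' ⟨x, rfl⟩) (hy' ⟨y, rfl⟩)
    | single g c =>
      rw [AddMonoidAlgebra.mapDomainAlgHom_apply, AddMonoidAlgebra.mapDomain_single, ← mul_one c,
        ← AddMonoidAlgebra.smul_single']
      exact Subalgebra.smul_mem _
        (Algebra.subset_adjoin (Set.mem_image_of_mem _ ((hS _).mpr ⟨g, rfl⟩))) c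
  · refine Algebra.adjoin_le ?_
    rintro _ ⟨m, hm, rfl⟩
    obtain ⟨g, rfl⟩ := (hS m).mp hm
    refine (AlgHom.mem_range _).mpr ⟨AddMonoidAlgebra.single g 1, ?_⟩
    rw [AddMonoidAlgebra.mapDomainAlgHom_apply, AddMonoidAlgebra.mapDomain_single]

/-- **Monomial algebras of embedded lattices.** If `ι : G → ℤ²` is an injective additive map with
image the set `S` of lattice points and the monoid algebra `k[G]` is a regular ring, then the
monomial algebra `k[S] ⊆ k[ℤ²]` is a regular ring: `χᵍ ↦ χ^{ι g}` is an injective `k`-algebra map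
(`AddMonoidAlgebra.mapDomain_injective`) with range `k[S]`
(`toricDegenerate_range_mapDomainAlgHom`), so `k[S] ≅ k[G]` (`AlgEquiv.ofInjective`,
`Subalgebra.equivOfEq`) and regularity is transported (`IsRegularRing.of_ringEquiv`).
[folklore] -/
theorem toricDegenerate_isRegularRing_adjoin {G : Type} [AddCommMonoid G]
    [IsRegularRing (AddMonoidAlgebra k G)] (ι : G →+ ℤ × ℤ) (hι : Function.Injective ι)
    (S : Set (ℤ × ℤ)) (hS : ∀ m, m ∈ S ↔ ∃ g, ι g = m) :
    IsRegularRing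
      ↥(Algebra.adjoin k ((fun m : ℤ × ℤ => AddMonoidAlgebra.single m (1 : k)) '' S)) := by
  let φ : AddMonoidAlgebra k G →ₐ[k] Lk := AddMonoidAlgebra.mapDomainAlgHom k k ι
  have hφinj : Function.Injective φ := fun p q hpq =>
    AddMonoidAlgebra.mapDomain_injective hι
      (by rwa [AddMonoidAlgebra.mapDomainAlgHom_apply,
        AddMonoidAlgebra.mapDomainAlgHom_apply] at hpq)
  exact IsRegularRing.of_ringEquiv
    ((AlgEquiv.ofInjective φ hφinj).trans
      (Subalgebra.equivOfEq _ _ (toricDegenerate_range_mapDomainAlgHom k ι S hS))).toRingEquiv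

/-- For `1 ≤ a` the lattice points of the degenerate cone `σS[0, a] = {0 ≤ m₂, a m₂ ≤ 0}` are
exactly the line `ℤ × {0}`, the image of `n ↦ (n, 0)`. -/
theorem toricDegenerate_mem_iff_of_pos (a : ℕ) (ha : 1 ≤ a) (m : ℤ × ℤ) :
    m ∈ σS[0, a] ↔ ∃ n : ℤ, AddMonoidHom.inl ℤ ℤ n = m := by
  have ha' : (1 : ℤ) ≤ (a : ℤ) := by exact_mod_cast ha
  simp only [Set.mem_setOf_eq, Nat.cast_zero, zero_mul, AddMonoidHom.inl_apply]
  constructor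
  · rintro ⟨h2, h1⟩
    have h0 : m.2 = 0 := by nlinarith
    exact ⟨m.1, Prod.ext rfl h0.symm⟩
  · rintro ⟨n, rfl⟩
    simp

/-- The lattice points of the degenerate cone `σS[0, 0] = {0 ≤ m₂, 0 ≤ 0}` are exactly the half
plane `ℤ × ℕ`, the image of `(n, d) ↦ (n, d)`. -/
theorem toricDegenerate_mem_iff_zero (m : ℤ × ℤ) :
    m ∈ σS[0, 0] ↔ ∃ g : ℤ × ℕ,
      (AddMonoidHom.prod (AddMonoidHom.fst ℤ ℕ)
        ((Nat.castAddMonoidHom ℤ).comp (AddMonoidHom.snd ℤ ℕ))) g = m := by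
  simp only [Set.mem_setOf_eq, Nat.cast_zero, zero_mul, le_refl, and_true,
    AddMonoidHom.prod_apply, AddMonoidHom.coe_fst, AddMonoidHom.coe_comp, Function.comp_apply,
    AddMonoidHom.coe_snd, Nat.coe_castAddMonoidHom]
  constructor
  · intro h
    exact ⟨(m.1, m.2.toNat), Prod.ext rfl (Int.toNat_of_nonneg h)⟩
  · rintro ⟨g, rfl⟩
    exact Int.natCast_nonneg _

/-- **The degenerate toric algebras are regular** (registered stub
`stub_toric_degenerate_isRegularRing`, crux stmt-ResolutionOfSingularities-15317, line
`redirect`): for every `a`, the toric surface algebra `TA[0, a] = k[{0 ≤ m₂, a m₂ ≤ 0}] ⊆ k[ℤ²]`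
of the degenerate parameter `r = 0` is a regular ring. For `1 ≤ a` it is the monomial algebra of
the line `ℤ × {0}` (`toricDegenerate_mem_iff_of_pos`), a copy of the regular Laurent polynomial
ring `k[ℤ] = k[t, t⁻¹]` (`toricDegenerate_laurentPolynomial_isRegularRing`); for `a = 0` it is
the monomial algebra of the half plane `ℤ × ℕ` (`toricDegenerate_mem_iff_zero`), a copy of the
regular ring `k[ℤ × ℕ] = k[t, t⁻¹][s]` (`toricDegenerate_halfPlaneAlgebra_isRegularRing`); in
both cases regularity is transported along the lattice embedding
(`toricDegenerate_isRegularRing_adjoin`). [folklore; Cox–Little–Schenck 2011, Ex. 1.2.21] -/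
theorem stub_toric_degenerate_isRegularRing (a : ℕ) : IsRegularRing ↥TA[0, a] := by
  rcases Nat.eq_zero_or_pos a with rfl | ha
  · -- `a = 0`: the half plane `ℤ × ℕ`
    haveI := toricDegenerate_halfPlaneAlgebra_isRegularRing k
    have hι : Function.Injective (AddMonoidHom.prod (AddMonoidHom.fst ℤ ℕ)
        ((Nat.castAddMonoidHom ℤ).comp (AddMonoidHom.snd ℤ ℕ))) := by
      rintro ⟨n, d⟩ ⟨n', d'⟩ h
      simp only [AddMonoidHom.prod_apply, AddMonoidHom.coe_fst, AddMonoidHom.coe_comp,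
        Function.comp_apply, AddMonoidHom.coe_snd, Nat.coe_castAddMonoidHom, Prod.mk.injEq,
        Nat.cast_inj] at h
      exact Prod.ext h.1 h.2
    exact toricDegenerate_isRegularRing_adjoin k _ hι _ (toricDegenerate_mem_iff_zero)
  · -- `1 ≤ a`: the line `ℤ × {0}`
    haveI : IsRegularRing (AddMonoidAlgebra k ℤ) :=
      toricDegenerate_laurentPolynomial_isRegularRing k
    have hι : Function.Injective (AddMonoidHom.inl ℤ ℤ) := fun n n' h => by
      simpa only [AddMonoidHom.inl_apply, Prod.mk.injEq, and_true] using h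
    exact toricDegenerate_isRegularRing_adjoin k _ hι _ (toricDegenerate_mem_iff_of_pos a ha)

end Toric

end Summit.ResolutionOfSingularities.ResolutionOfSingularities.Theorems.FRationalResolution

end
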